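import Mathlib
import Summits.PneNP.PneNP.Theorems.OneSliceSliceTargetSplitTransport

/-!
# Route OneSlice, crux `SliceTarget` (stmt-PneNP-2832) — split `SliceTarget ⟸ MonotoneContinuation ∧ SingleThreshold`,
# part II: `k`-CLIQUE is transport-stable

The clique function survives the slice transport of part I: transporting `𝟙[CLIQUE_k]` from slice `j` to a vector `y`
of weight `i` changes it only if a uniformly random comparable pair `(x, y)` between the slices `j` and `i` separates
"has a `k`-clique" — which requires the random `|i - j|` deleted edges to hit ONE FIXED `k`-clique of the larger vector,
an event of probability `≤ C(k,2)·|i - j| / max(i,j)` (`sum_card_bad_le`, `sliceSum_transport_clique_le`; no clique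
counting is needed). Mixing over the binomial law of `|G(n,p)|` with Chebyshev for the far slices gives the
`L¹(G(n,p))` stability estimate `l1_transport_clique_le`:
`‖T𝟙[CLIQUE_k] − 𝟙[CLIQUE_k]‖ ≤ C(k,2)·W/L + Np(1-p)/t²` whenever the slices within `W` of `j` have weight `≥ L` and
the others are `t`-far from the mean.

Strategist seat planner-cstrat-stmt-PneNP-2832-r1-0, 2026-08-17.
-/

set_option linter.dupNamespace false -- `Summit.PneNP.PneNP.…`: summit = sub-problem (D-0017)

namespace Summit.PneNP.PneNP.Theorems.SliceTargetSplit

open Literature.Computability.Complexity hiding supp mem_supp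
open Finset hiding slice
open Filter hiding mem_sdiff
open Classical
open Summit.PneNP.PneNP.Theorems.ConstantBand.Negative (Edge slice)
open Summit.PneNP.PneNP.Theorems.SliceACZero.Negative (supp mem_supp card_supp supp_injective
  supp_indicator)

noncomputable section

variable {n : ℕ}

/-! ### The transport error of an indicator, pointwise and per slice -/

/-- A transported indicator lies in `[0,1]`. [folklore] -/
theorem transport_ind_mem {j : ℕ} (f : (Edge n → Bool) → Bool) (y : Edge n → Bool) :
    0 ≤ transport j (ind f) y ∧ transport j (ind f) y ≤ 1 := by
  refine ⟨transport_nonneg (ind_nonneg f) y, ?_⟩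
  unfold transport
  rcases Nat.eq_zero_or_pos #(nbhd j y) with h | h
  · rw [h, Nat.cast_zero, div_zero]; exact zero_le_one
  · rw [div_le_one (by exact_mod_cast h)]
    calc ∑ x ∈ nbhd j y, ind f x ≤ ∑ x ∈ nbhd j y, (1 : ℝ) := sum_le_sum fun x _ => ind_le_one f x
      _ = #(nbhd j y) := by rw [sum_const, nsmul_eq_mul, mul_one]

/-- The transport error of an indicator is at most `1` pointwise. [folklore] -/
theorem abs_transport_ind_sub_ind_le_one {j : ℕ} (f : (Edge n → Bool) → Bool) (y : Edge n → Bool) :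
    |transport j (ind f) y - ind f y| ≤ 1 := by
  have h1 := transport_ind_mem (j := j) f y
  have h2 := ind_nonneg f y
  have h3 := ind_le_one f y
  rw [abs_sub_le_iff]; constructor <;> linarith

/-- **Pointwise transport error**: at a vector with a nonempty neighbourhood, `|T𝟙[f](y) − 𝟙[f](y)|` is at most the
fraction of comparable slice-`j` vectors on which `f` differs from `f y`. [folklore] -/
theorem abs_transport_ind_sub_ind_le {j : ℕ} (f : (Edge n → Bool) → Bool) {y : Edge n → Bool}
    (hD : 0 < #(nbhd j y)) :
    |transport j (ind f) y - ind f y| ≤ (#((nbhd j y).filter fun x => f x ≠ f y) : ℝ) / #(nbhd j y) := by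
  have hD' : (0 : ℝ) < #(nbhd j y) := by exact_mod_cast hD
  have hrw : transport j (ind f) y - ind f y = (∑ x ∈ nbhd j y, (ind f x - ind f y)) / #(nbhd j y) := by
    rw [transport, sum_sub_distrib, sum_const, nsmul_eq_mul, sub_div, mul_div_cancel_left₀ _ hD'.ne']
  rw [hrw, abs_div, Nat.abs_cast]
  refine div_le_div_of_nonneg_right ?_ hD'.le
  refine (abs_sum_le_sum_abs _ _).trans ?_
  rw [← sum_boole]
  refine (sum_le_sum fun x _ => ?_)
  have := abs_ind_sub_ind f (fun _ => f y) x
  simp only [ind] at this ⊢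
  rw [this]

/-- **Per-slice transport error** (slices `i, j ≤ C(n,2)`): the slice-`i` sum of the transport error of `𝟙[f]` is at
most the number of separating comparable pairs over `D(N,i,j)`. [folklore] -/
theorem sliceSum_abs_transport_ind_sub_ind_le {i j : ℕ} (f : (Edge n → Bool) → Bool) (hi : i ≤ n.choose 2)
    (hj : j ≤ n.choose 2) :
    ∑ y ∈ slice n i, |transport j (ind f) y - ind f y|
      ≤ (∑ y ∈ slice n i, (#((nbhd j y).filter fun x => f x ≠ f y) : ℝ)) / nbhdCard (n.choose 2) i j := by
  rw [sum_div]
  refine sum_le_sum fun y hy => ?_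
  have hyi : edgeCount y = i := (mem_filter.1 hy).2
  rw [← card_nbhd hyi]
  exact abs_transport_ind_sub_ind_le f (by rw [card_nbhd hyi]; exact nbhdCard_pos hi hj)

/-! ### Separating pairs for `CLIQUE_k`: hit the witnessing clique -/

/-- Nested supports are ordered vectors. [folklore] -/
theorem le_of_supp_subset {x y : Edge n → Bool} (h : supp x ⊆ supp y) : x ≤ y := by
  intro e
  rw [Bool.le_iff_imp]
  intro hx
  exact mem_supp.1 (h (mem_supp.2 hx))

/-- `CLIQUE_k` is monotone along nested supports. [folklore] -/
theorem cliqueFn_of_supp_subset {k : ℕ} {x y : Edge n → Bool} (h : supp x ⊆ supp y)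
    (hx : cliqueFn n k x = true) : cliqueFn n k y = true := by
  have hmono := cliqueFn_monotone_holds n k (le_of_supp_subset h)
  rw [hx] at hmono
  exact top_le_iff.1 hmono

/-- A witnessing clique: `CLIQUE_k(z) = 1` gives a `k`-set `A` with `K_A ⊆ z`. [folklore] -/
theorem exists_cliqueVec_le {k : ℕ} {z : Edge n → Bool} (hz : cliqueFn n k z = true) :
    ∃ A ∈ powersetCard k (univ : Finset (Fin n)), ∀ e, cliqueVec A e = true → z e = true := by
  have hne := (cliqueCount_ne_zero_iff z).2 hz
  rw [Ne, cliqueCount_eq_zero_iff_forall] at hne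
  push Not at hne
  exact hne

/-- Containing `K_A` for a `k`-set `A` forces `CLIQUE_k = 1`. [folklore] -/
theorem cliqueFn_of_cliqueVec_le {k : ℕ} {A : Finset (Fin n)} (hA : A ∈ powersetCard k (univ : Finset (Fin n)))
    {x : Edge n → Bool} (hx : ∀ e, cliqueVec A e = true → x e = true) : cliqueFn n k x = true := by
  have hk : k ≤ #A := (mem_powersetCard.1 hA).2.ge
  refine cliqueFn_of_supp_subset (x := cliqueVec A) ?_ (cliqueFn_cliqueVec hk)
  intro e he
  exact mem_supp.2 (hx e (mem_supp.1 he))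

/-- Slice-`a` vectors below `z` avoiding a fixed on-edge `e` of `z`: at most `C(e(z) - 1, a)`. [folklore] -/
theorem card_nbhd_filter_false_le {a : ℕ} {z : Edge n → Bool} (haz : a ≤ edgeCount z) {e : Edge n}
    (he : z e = true) :
    #((nbhd a z).filter fun x => x e = false) ≤ (edgeCount z - 1).choose a := by
  have hcard : #((supp z).erase e) = edgeCount z - 1 := by
    rw [card_erase_of_mem (mem_supp.2 he), card_supp]
  rw [← hcard, ← card_powersetCard]
  refine card_le_card_of_injOn supp ?_ (supp_injective.injOn)
  intro x hx
  rw [mem_coe, mem_filter, mem_nbhd] at hx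
  obtain ⟨⟨hxa, hcomp⟩, hxe⟩ := hx
  rw [mem_coe, mem_powersetCard]
  refine ⟨?_, by rw [card_supp, hxa]⟩
  intro e' he'
  rw [mem_erase]
  refine ⟨?_, supp_subset_of_comp_of_le hcomp (hxa ▸ haz) he'⟩
  rintro rfl
  rw [mem_supp] at he'
  rw [he'] at hxe
  exact Bool.noConfusion hxe

/-- **Separating a vector from its lower neighbourhood costs a hit on the witnessing clique.** For `z` of weight
`b ≥ a`, the slice-`a` vectors comparable with (hence below) `z` on which `CLIQUE_k` differs from `CLIQUE_k(z)` number
at most `C(k,2) · C(b - 1, a)`. [folklore] -/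
theorem card_bad_nbhd_le {k a b : ℕ} (hab : a ≤ b) {z : Edge n → Bool} (hz : edgeCount z = b) :
    #((nbhd a z).filter fun x => cliqueFn n k x ≠ cliqueFn n k z) ≤ k.choose 2 * (b - 1).choose a := by
  cases hfz : cliqueFn n k z
  · -- no clique above: nothing below has one either
    have : (nbhd a z).filter (fun x => cliqueFn n k x ≠ false) = ∅ := by
      refine filter_eq_empty_iff.2 fun x hx hne => ?_
      rw [mem_nbhd] at hx
      have hsub : supp x ⊆ supp z := supp_subset_of_comp_of_le hx.2 (by rw [hx.1, hz]; exact hab)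
      have := cliqueFn_of_supp_subset (k := k) hsub (by simpa using hne)
      rw [hfz] at this
      exact Bool.noConfusion this
    rw [this, card_empty]
    exact Nat.zero_le _
  · obtain ⟨A, hA, hAz⟩ := exists_cliqueVec_le hfz
    set EA : Finset (Edge n) := univ.filter fun e => cliqueVec A e = true with hEA
    have hEAcard : #EA = k.choose 2 := by
      rw [hEA, card_filter_cliqueVec, (mem_powersetCard.1 hA).2]
    have hsub : (nbhd a z).filter (fun x => cliqueFn n k x ≠ true) ⊆
        EA.biUnion fun e => (nbhd a z).filter fun x => x e = false := by
      intro x hx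
      rw [mem_filter] at hx
      obtain ⟨hxn, hne⟩ := hx
      have hxf : cliqueFn n k x = false := by simpa using hne
      have : ¬ ∀ e, cliqueVec A e = true → x e = true := by
        intro h
        have := cliqueFn_of_cliqueVec_le hA h
        rw [hxf] at this
        exact Bool.noConfusion this
      push Not at this
      obtain ⟨e, heA, hxe⟩ := this
      rw [mem_biUnion]
      refine ⟨e, by rw [hEA, mem_filter]; exact ⟨mem_univ _, heA⟩, ?_⟩
      rw [mem_filter]
      exact ⟨hxn, by simpa using hxe⟩
    calc #((nbhd a z).filter fun x => cliqueFn n k x ≠ true)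
        ≤ #(EA.biUnion fun e => (nbhd a z).filter fun x => x e = false) := card_le_card hsub
      _ ≤ ∑ e ∈ EA, #((nbhd a z).filter fun x => x e = false) := card_biUnion_le
      _ ≤ ∑ e ∈ EA, (b - 1).choose a := sum_le_sum fun e he => by
          rw [← hz]
          exact card_nbhd_filter_false_le (hz ▸ hab) (hAz e (mem_filter.1 he).2)
      _ = k.choose 2 * (b - 1).choose a := by rw [sum_const, smul_eq_mul, hEAcard]

/-- Double counting of separating pairs (cardinality form). [folklore] -/
theorem sum_card_filter_nbhd_comm (i j : ℕ) (P : (Edge n → Bool) → (Edge n → Bool) → Prop)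
    [∀ x y, Decidable (P x y)] :
    ∑ y ∈ slice n i, (#((nbhd j y).filter fun x => P x y) : ℝ) =
      ∑ x ∈ slice n j, (#((nbhd i x).filter fun y => P x y) : ℝ) := by
  have h := sum_slice_sum_nbhd i j (fun x y => if P x y then (1 : ℝ) else 0)
  simp only [sum_boole] at h
  exact_mod_cast h

/-- **Separating pairs, lower slice `j ≤ i`**: summed over the slice `i`, at most `C(N,i)·C(k,2)·C(i-1,j)`. [folklore] -/
theorem sum_card_bad_le_of_le {i j k : ℕ} (hji : j ≤ i) :
    ∑ y ∈ slice n i, (#((nbhd j y).filter fun x => cliqueFn n k x ≠ cliqueFn n k y) : ℝ)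
      ≤ ((n.choose 2).choose i : ℝ) * ((k.choose 2 : ℝ) * ((i - 1).choose j : ℕ)) := by
  have : ∀ y ∈ slice n i, (#((nbhd j y).filter fun x => cliqueFn n k x ≠ cliqueFn n k y) : ℝ)
      ≤ (k.choose 2 : ℝ) * ((i - 1).choose j : ℕ) := fun y hy => by
    exact_mod_cast card_bad_nbhd_le hji (mem_filter.1 hy).2
  refine (sum_le_sum this).trans ?_
  rw [sum_const, nsmul_eq_mul, card_slice]

/-- **Separating pairs, upper slice `i ≤ j`**: summed over the slice `i` (by double counting, from the slice-`j` side),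
at most `C(N,j)·C(k,2)·C(j-1,i)`. [folklore] -/
theorem sum_card_bad_le_of_ge {i j k : ℕ} (hij : i ≤ j) :
    ∑ y ∈ slice n i, (#((nbhd j y).filter fun x => cliqueFn n k x ≠ cliqueFn n k y) : ℝ)
      ≤ ((n.choose 2).choose j : ℝ) * ((k.choose 2 : ℝ) * ((j - 1).choose i : ℕ)) := by
  refine (sum_card_filter_nbhd_comm i j (fun x y => cliqueFn n k x ≠ cliqueFn n k y)).trans_le ?_
  have : ∀ x ∈ slice n j, (#((nbhd i x).filter fun y => cliqueFn n k x ≠ cliqueFn n k y) : ℝ)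
      ≤ (k.choose 2 : ℝ) * ((j - 1).choose i : ℕ) := fun x hx => by
    rw [filter_congr (fun y _ => ne_comm)]
    exact_mod_cast card_bad_nbhd_le hij (mem_filter.1 hx).2
  refine (sum_le_sum this).trans ?_
  rw [sum_const, nsmul_eq_mul, card_slice]

/-- The binomial identity behind "the deleted edges hit a fixed clique", `C(b-1,a)·b = C(b,a)·(b-a)`, in the
inequality form used (`0 ≤ L ≤ b`). [folklore] -/
theorem choose_pred_mul_le {a b : ℕ} (hab : a ≤ b) {L : ℝ} (hL0 : 0 ≤ L) (hL : L ≤ b) :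
    (((b - 1).choose a : ℕ) : ℝ) * L ≤ (b.choose a : ℝ) * ((b : ℝ) - a) := by
  rcases Nat.eq_zero_or_pos b with rfl | hb
  · have ha : a = 0 := Nat.le_zero.1 hab
    subst ha
    simp only [Nat.cast_zero] at hL
    have hL' : L = 0 := le_antisymm hL hL0
    simp [hL']
  · obtain ⟨b', rfl⟩ : ∃ b', b = b' + 1 := ⟨b - 1, by omega⟩
    have hkey := Nat.choose_mul_succ_eq b' a
    have hkeyR : ((b'.choose a : ℕ) : ℝ) * ((b' : ℝ) + 1) = ((b' + 1).choose a : ℝ) * ((b' : ℝ) + 1 - a) := by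
      have := congrArg (Nat.cast (R := ℝ)) hkey
      push_cast [Nat.cast_sub hab] at this
      exact this
    rw [show b' + 1 - 1 = b' by omega]
    push_cast at hL ⊢
    calc ((b'.choose a : ℕ) : ℝ) * L ≤ ((b'.choose a : ℕ) : ℝ) * ((b' : ℝ) + 1) :=
          mul_le_mul_of_nonneg_left hL (Nat.cast_nonneg _)
      _ = ((b' + 1).choose a : ℝ) * ((b' : ℝ) + 1 - a) := hkeyR

/-- **Per-slice stability of `CLIQUE_k`.** For slices `i, j ≤ C(n,2)` of weight at least `L > 0`, the slice-`i` sum of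
the transport error of `𝟙[CLIQUE_k]` is at most `C(N,i) · C(k,2) · |i - j| / L`. [folklore] -/
theorem sliceSum_transport_clique_le {i j k : ℕ} (hi : i ≤ n.choose 2) (hj : j ≤ n.choose 2) {L : ℝ} (hL0 : 0 < L)
    (hLi : L ≤ i) (hLj : L ≤ j) :
    ∑ y ∈ slice n i, |transport j (ind (cliqueFn n k)) y - ind (cliqueFn n k) y|
      ≤ ((n.choose 2).choose i : ℝ) * (k.choose 2 * |(i : ℝ) - j| / L) := by
  set N := n.choose 2 with hN
  have hD := nbhdCard_pos hi hj
  have hD' : (0 : ℝ) < nbhdCard N i j := by exact_mod_cast hD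
  refine (sliceSum_abs_transport_ind_sub_ind_le (cliqueFn n k) hi hj).trans ?_
  rw [div_le_iff₀ hD']
  rcases le_total j i with hji | hij
  · -- lower slice: `D = C(i,j)` and `C(i-1,j)·L ≤ C(i,j)·(i-j)`
    have hDij : (nbhdCard N i j : ℝ) = (i.choose j : ℝ) := by rw [nbhdCard, if_pos hji]
    have habs : |(i : ℝ) - j| = (i : ℝ) - j := abs_of_nonneg (by simpa using (Nat.cast_le (α := ℝ)).2 hji)
    have hkey := choose_pred_mul_le hji hL0.le hLi
    refine (sum_card_bad_le_of_le (k := k) hji).trans ?_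
    rw [hDij, habs]
    have hCK : 0 ≤ ((N.choose i : ℕ) : ℝ) * (k.choose 2 : ℝ) := by positivity
    calc ((N.choose i : ℕ) : ℝ) * ((k.choose 2 : ℝ) * ((i - 1).choose j : ℕ))
        = ((N.choose i : ℕ) : ℝ) * (k.choose 2 : ℝ) * ((((i - 1).choose j : ℕ) : ℝ) * L) / L := by
          field_simp
      _ ≤ ((N.choose i : ℕ) : ℝ) * (k.choose 2 : ℝ) * ((i.choose j : ℝ) * ((i : ℝ) - j)) / L := by
          exact div_le_div_of_nonneg_right (mul_le_mul_of_nonneg_left hkey hCK) hL0.le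
      _ = ((N.choose i : ℕ) : ℝ) * (k.choose 2 * ((i : ℝ) - j) / L) * (i.choose j : ℝ) := by ring
  · -- upper slice: `C(N,i)·D = C(N,j)·C(j,i)` and `C(j-1,i)·L ≤ C(j,i)·(j-i)`
    have hrec : ((N.choose i : ℕ) : ℝ) * (nbhdCard N i j : ℝ) = (N.choose j : ℝ) * (j.choose i : ℝ) := by
      have := choose_mul_nbhdCard N i j
      rw [show nbhdCard N j i = j.choose i by rw [nbhdCard, if_pos hij]] at this
      exact_mod_cast this
    have habs : |(i : ℝ) - j| = (j : ℝ) - i := by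
      rw [abs_sub_comm]; exact abs_of_nonneg (by simpa using (Nat.cast_le (α := ℝ)).2 hij)
    have hkey := choose_pred_mul_le hij hL0.le hLj
    refine (sum_card_bad_le_of_ge (k := k) hij).trans ?_
    rw [habs]
    have hCK : 0 ≤ ((N.choose j : ℕ) : ℝ) * (k.choose 2 : ℝ) := by positivity
    calc ((N.choose j : ℕ) : ℝ) * ((k.choose 2 : ℝ) * ((j - 1).choose i : ℕ))
        = ((N.choose j : ℕ) : ℝ) * (k.choose 2 : ℝ) * ((((j - 1).choose i : ℕ) : ℝ) * L) / L := by
          field_simp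
      _ ≤ ((N.choose j : ℕ) : ℝ) * (k.choose 2 : ℝ) * ((j.choose i : ℝ) * ((j : ℝ) - i)) / L := by
          exact div_le_div_of_nonneg_right (mul_le_mul_of_nonneg_left hkey hCK) hL0.le
      _ = (k.choose 2 * ((j : ℝ) - i) / L) * (((N.choose j : ℕ) : ℝ) * (j.choose i : ℝ)) := by ring
      _ = ((N.choose i : ℕ) : ℝ) * (k.choose 2 * ((j : ℝ) - i) / L) * (nbhdCard N i j : ℝ) := by
          rw [← hrec]; ring

/-! ### Mixing over `G(n,p)`: the stability estimate -/

/-- **`L¹(G(n,p))` stability of `CLIQUE_k` under slice transport.** Let `j ≤ C(n,2)`. Suppose the edge counts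
`i ≤ C(n,2)` split into GOOD ones, of weight `≥ L > 0` and within `W` of `j`, and the others, at distance `≥ t > 0`
from the mean `C(n,2)·p`. Then `‖T_j𝟙[CLIQUE_k] − 𝟙[CLIQUE_k]‖_{L¹(G(n,p))} ≤ C(k,2)·W/L + C(n,2)p(1-p)/t²`. [folklore] -/
theorem l1_transport_clique_le {k j : ℕ} {p : ℝ} (hp0 : 0 ≤ p) (hp1 : p ≤ 1) (hj : j ≤ n.choose 2)
    (Good : ℕ → Prop) {L W t : ℝ} (hL0 : 0 < L) (hW : 0 ≤ W) (ht : 0 < t) (hLj : L ≤ j)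
    (hgood : ∀ i, Good i → L ≤ i ∧ |(i : ℝ) - j| ≤ W)
    (hbad : ∀ i, i ≤ n.choose 2 → ¬ Good i → t ≤ |(i : ℝ) - (n.choose 2 : ℕ) * p|) :
    l1 n p (transport j (ind (cliqueFn n k))) (ind (cliqueFn n k))
      ≤ k.choose 2 * W / L + (n.choose 2 : ℕ) * p * (1 - p) / t ^ 2 := by
  set N := n.choose 2 with hN
  set b : ℕ → ℝ := fun i => (N.choose i : ℝ) * p ^ i * (1 - p) ^ (N - i) with hbdef
  have hb : ∀ i, b i = (N.choose i : ℝ) * p ^ i * (1 - p) ^ (N - i) := fun i => rfl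
  set E : ℕ → ℝ := fun i =>
    ∑ y ∈ slice n i, |transport j (ind (cliqueFn n k)) y - ind (cliqueFn n k) y| with hE
  have hE0 : ∀ i, 0 ≤ E i := fun i => sum_nonneg fun y _ => abs_nonneg _
  -- every slice: `E i ≤ C(N,i)`; good slices: `E i ≤ C(N,i)·K W/L`
  have hEall : ∀ i, E i ≤ (N.choose i : ℝ) := fun i => by
    calc E i ≤ ∑ y ∈ slice n i, (1 : ℝ) :=
          sum_le_sum fun y _ => abs_transport_ind_sub_ind_le_one (cliqueFn n k) y
      _ = (N.choose i : ℝ) := by rw [sum_const, nsmul_eq_mul, mul_one, card_slice]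
  have hEgood : ∀ i, i ≤ N → Good i → E i ≤ (N.choose i : ℝ) * (k.choose 2 * W / L) := fun i hi hgi => by
    obtain ⟨hLi, hiW⟩ := hgood i hgi
    refine (sliceSum_transport_clique_le (k := k) hi hj hL0 hLi hLj).trans ?_
    refine mul_le_mul_of_nonneg_left ?_ (Nat.cast_nonneg _)
    exact div_le_div_of_nonneg_right (mul_le_mul_of_nonneg_left hiW (Nat.cast_nonneg _)) hL0.le
  have hq : ∀ i, 0 ≤ p ^ i * (1 - p) ^ (N - i) := fun i =>
    mul_nonneg (pow_nonneg hp0 _) (pow_nonneg (sub_nonneg.2 hp1) _)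
  rw [l1_eq_sum_slices]
  change ∑ i ∈ range (N + 1), p ^ i * (1 - p) ^ (N - i) * E i ≤ _
  rw [← sum_filter_add_sum_filter_not (range (N + 1)) Good]
  refine add_le_add ?_ ?_
  · -- good slices
    calc ∑ i ∈ (range (N + 1)).filter Good, p ^ i * (1 - p) ^ (N - i) * E i
        ≤ ∑ i ∈ (range (N + 1)).filter Good, b i * (k.choose 2 * W / L) := by
          refine sum_le_sum fun i hi => ?_
          obtain ⟨hir, hgi⟩ := mem_filter.1 hi
          have hiN : i ≤ N := Nat.lt_succ_iff.1 (mem_range.1 hir)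
          calc p ^ i * (1 - p) ^ (N - i) * E i ≤ p ^ i * (1 - p) ^ (N - i) * ((N.choose i : ℝ) * (k.choose 2 * W / L)) :=
                mul_le_mul_of_nonneg_left (hEgood i hiN hgi) (hq i)
            _ = b i * (k.choose 2 * W / L) := by rw [hb]; ring
      _ = (∑ i ∈ (range (N + 1)).filter Good, b i) * (k.choose 2 * W / L) := by rw [sum_mul]
      _ ≤ 1 * (k.choose 2 * W / L) := by
          refine mul_le_mul_of_nonneg_right ?_ (by positivity)
          calc ∑ i ∈ (range (N + 1)).filter Good, b i ≤ ∑ i ∈ range (N + 1), b i :=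
                sum_le_sum_of_subset_of_nonneg (filter_subset _ _) fun i _ _ => binomialWeight_nonneg hb hp0 hp1 i
            _ = 1 := binomialWeight_sum_range hb
      _ = k.choose 2 * W / L := one_mul _
  · -- far slices: Chebyshev
    calc ∑ i ∈ (range (N + 1)).filter (fun i => ¬ Good i), p ^ i * (1 - p) ^ (N - i) * E i
        ≤ ∑ i ∈ (range (N + 1)).filter (fun i => ¬ Good i), b i := by
          refine sum_le_sum fun i _ => ?_
          calc p ^ i * (1 - p) ^ (N - i) * E i ≤ p ^ i * (1 - p) ^ (N - i) * (N.choose i : ℝ) :=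
                mul_le_mul_of_nonneg_left (hEall i) (hq i)
            _ = b i := by rw [hb]; ring
      _ = ∑ i ∈ (range (N + 1)).filter (fun i => i ≤ N ∧ ¬ Good i), b i := by
          refine sum_congr (filter_congr fun i hi => ?_) fun _ _ => rfl
          have hiN : i ≤ N := Nat.lt_succ_iff.1 (mem_range.1 hi)
          exact ⟨fun h => ⟨hiN, h⟩, fun h => h.2⟩
      _ ≤ (N : ℝ) * p * (1 - p) / t ^ 2 :=
          binomialWeight_tail_le hb hp0 hp1 ht (fun i => i ≤ N ∧ ¬ Good i) fun i hi => hbad i hi.1 hi.2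

end

end Summit.PneNP.PneNP.Theorems.SliceTargetSplit
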